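import Literature.MathematicalPhysics.QuantumLattice.HubbardGridFlowBudget
import Literature.MathematicalPhysics.QuantumLattice.GrassmannEffectiveActionScales
import HarnessLib

/-!
# The multiscale flow of the Hubbard torus at `βU ≤ κ` closes: units of the single-scale partition functions and the pinned norms
# of the untracked remainder after the last scale

Topic `MathematicalPhysics/QuantumLattice`; cell gate-hubbard-kl, R0-SCOPE-4 W7 (assembly).  For a valid run `S` (`FlowSetup.Valid`,
`HubbardGridFlowBudget`) the refined split flow `GrassmannFlowDBRefined.iterEffAction_splitFlow_geometric_refined_of_gramBounded` is
instantiated on the grid legs with the covariances `C_j` of `HubbardGridScaleCovariances`, the initial interaction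
`V = u V₁ + ν₀ N₂` (`gridTracked`), the tracked family `L_j = u V₁ + ν_j N₂` (`ν_{j+1} = ν_j + u t_j`: `kernel_gaussConv_gridTracked`), the
pinned norms `gridTrackedNL`, the constant contraction parameter `x_j = x̄` (`flow_x_eq`), the deviation constants `D_j = flowD …`
(clamped to `0` beyond `K + 1`) and the budget `P_j` (`theta_le` gives `θ_j ≤ 1/30`).  Results:

* **`FlowSetup.Valid.flow`** — for every `n ≤ K + 1`: all single-scale partition functions `Z_j`, `j < n`, are units, `𝒱^{(n)}` is even
  without constant part, and `Σ_{Y : Y_p = w} ‖kernel_m(𝒱^{(n)} - L_n)(Y)‖ ≤ D_n t_n^m`;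
* `FlowSetup.Valid.isUnit_effPartitionFn_full`, `FlowSetup.Valid.effAction_full_eq` — the total partition function over
  `Sᵀ C^θ S = Σ_{j ≤ K} C_j` is a unit and its effective action is `𝒱^{(K+1)}`;
* `FlowSetup.Valid.D_last_le`, `FlowSetup.Valid.t_last_sq`, `FlowSetup.Valid.D_last_mul_t_sq_le` — `D_{K+1} ≤ (1/29) e/a_K` and
  `D_{K+1} t_{K+1}² ≤ (1/29) π√(π/β)/(C_sl N) = O(β^{-1/2}/N)`.

Everything is proved; `FlowSetup.V`, `FlowSetup.Lj`, `FlowSetup.D` are the only definitions; no named facts.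

## Sources

G. Benfatto, A. Giuliani, V. Mastropietro, Ann. Henri Poincaré 7 (2006) 809–898, §2.2 (2.12)–(2.14), §2.8 (2.80)–(2.88)
(`BenfattoGiulianiMastropietro2006`).
-/

noncomputable section

namespace Literature.MathematicalPhysics.QuantumLattice

open Literature.Probability.LatticeModels GrassmannAlgebra Finset Complex

namespace FlowSetup

variable {L M N : ℕ} [NeZero L] [NeZero N] (S : FlowSetup L M N)

/-- **The initial interaction** `V = u V₁ + ν₀ N₂` on the grid. [cite: BenfattoGiulianiMastropietro2006, §2.1 (2.6a)] -/
abbrev V : GrassmannAlgebra ℂ (GridLeg (GridPoint L N)) := gridTracked L N S.β S.u S.ν₀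

/-- **The tracked family** `L_j = u V₁ + ν_j N₂`. [cite: BenfattoGiulianiMastropietro2006, §2.8 (2.86)] -/
abbrev Lj (j : ℕ) : GrassmannAlgebra ℂ (GridLeg (GridPoint L N)) := gridTracked L N S.β S.u (S.nu j)

/-- **The deviation constants**: `flowD` with the constant contraction parameter `x̄`, clamped to `0` beyond `K + 1`.
[cite: BenfattoGiulianiMastropietro2006, §2.8 (2.85)] -/
def D (j : ℕ) : ℝ := if j ≤ S.K + 1 then flowD (fun _ => flowX) S.alp S.kap S.lam j else 0

variable {S}

omit [NeZero N] in
/-- `D_j = flowD … j` for `j ≤ K + 1`. [cite: BenfattoGiulianiMastropietro2006, §2.8 (2.85)] -/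
theorem D_of_le {j : ℕ} (hj : j ≤ S.K + 1) : S.D j = flowD (fun _ => flowX) S.alp S.kap S.lam j := by simp [D, hj]

/-- The budget lemma applied: for `j ≤ K`, `0 ≤ flowD_j ≤ P_j` and `θ_j ≤ ε`. [cite: BenfattoGiulianiMastropietro2006, §2.8 (2.88)] -/
theorem Valid.budget (h : S.Valid) :
    ∀ j ≤ S.K, 0 ≤ flowD (fun _ => flowX) S.alp S.kap S.lam j ∧ flowD (fun _ => flowX) S.alp S.kap S.lam j ≤ S.P j ∧
      Real.exp 1 * S.alp j * (S.lam j + flowD (fun _ => flowX) S.alp S.kap S.lam j * flowX ^ 2 / (1 - flowX ^ 2)) / S.kap j ^ 2 ≤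
        flowEps :=
  flowD_budget_quadratic (fun j => (h.alp_pos j).le) h.kap_pos h.lam_nonneg (fun _ => flowX_sq_lt_one) flowEps_lt_one S.P h.P_nonneg
    S.K (fun j _ => (S.P_succ j).symm.le) (fun _ hj => theta_le h hj)

/-- `0 ≤ D_j` for every `j`. [cite: BenfattoGiulianiMastropietro2006, §2.8 (2.85)] -/
theorem Valid.D_nonneg (h : S.Valid) (j : ℕ) : 0 ≤ S.D j := by
  unfold D
  split_ifs with hj
  · rcases Nat.lt_or_ge j (S.K + 1) with hlt | hge
    · exact (h.budget j (by omega)).1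
    · -- `j = K + 1`: one more step from `θ_K ≤ ε < 1`
      have hjK : j = S.K + 1 := le_antisymm hj hge
      subst hjK
      obtain ⟨hD0, -, hθ⟩ := h.budget S.K le_rfl
      rw [flowD_succ]
      have hg : 0 ≤ flowX ^ 2 / (1 - flowX ^ 2) := div_nonneg (sq_nonneg _) (by linarith [flowX_sq_lt_one])
      have hDg : 0 ≤ flowD (fun _ => flowX) S.alp S.kap S.lam S.K * flowX ^ 2 / (1 - flowX ^ 2) := by
        rw [mul_div_assoc]; exact mul_nonneg hD0 hg
      have hθ0 : 0 ≤ Real.exp 1 * S.alp S.K * (S.lam S.K + flowD (fun _ => flowX) S.alp S.kap S.lam S.K * flowX ^ 2 / (1 - flowX ^ 2)) /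
          S.kap S.K ^ 2 :=
        div_nonneg (mul_nonneg (mul_nonneg (Real.exp_pos 1).le (h.alp_pos _).le) (add_nonneg (h.lam_nonneg _) hDg))
          (pow_pos (h.kap_pos _) 2).le
      have hθ1 := lt_of_le_of_lt hθ flowEps_lt_one
      refine mul_nonneg (Real.exp_pos 1).le (add_nonneg hDg (div_nonneg (mul_nonneg (add_nonneg (h.lam_nonneg _) hDg) hθ0) ?_))
      linarith
  · exact le_rfl

/-- **The flow closes.** For every `n ≤ K + 1`: units of the single-scale partition functions below `n`, parity and vanishing
constant part of `𝒱^{(n)}`, and the pinned norms of `𝒱^{(n)} - L_n` are `≤ D_n t_n^m`. [cite: BenfattoGiulianiMastropietro2006, §2.8 (2.85)-(2.88)] -/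
theorem Valid.flow (h : S.Valid) :
    ∀ n ≤ S.K + 1, (∀ j < n, IsUnit (effPartitionFn ℂ (S.cov j) (iterEffAction ℂ S.cov j S.V))) ∧
      iterEffAction ℂ S.cov n S.V ∈ evenPart ℂ (GridLeg (GridPoint L N)) ∧ constPart ℂ (iterEffAction ℂ S.cov n S.V) = 0 ∧
      ∀ (m : ℕ), 0 < m → ∀ (p : Fin m) (w : GridLeg (GridPoint L N)),
        ∑ Y ∈ univ.filter (fun Y : Fin m → GridLeg (GridPoint L N) => Y p = w),
          ‖kernel ℂ (iterEffAction ℂ S.cov n S.V - S.Lj n) m Y‖ ≤ S.D n * S.t n ^ m := by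
  have hβ := h.β_pos
  -- the flow of the tracked part
  have hLflow : ∀ j, ∀ m, 0 < m → ∀ Y : Fin m → GridLeg (GridPoint L N),
      kernel ℂ (gaussConv ℂ (S.cov j) (S.Lj j)) m Y = kernel ℂ (S.Lj (j + 1)) m Y := by
    intro j m hm Y
    show kernel ℂ (gaussConv ℂ (S.cov j) (gridTracked L N S.β S.u (S.nu j))) m Y =
      kernel ℂ (gridTracked L N S.β S.u (S.nu (j + 1))) m Y
    rw [show S.nu (j + 1) = S.nu j + S.u * S.tad j from flowNu_succ S.β S.μR S.θ S.Λ₀ S.K S.u S.ν₀ j]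
    exact kernel_gaussConv_gridTracked (S.cov j) (contr_gridScaleCov_of_charge_eq S.β S.μR S.θ S.Λ₀ flowR S.K j)
      (contr_gridScaleCov_of_spin_ne S.β S.μR S.θ S.Λ₀ flowR S.K j) (fun q σ => contr_gridScaleCov_samePoint S.β S.μR S.θ S.Λ₀ flowR S.K j q σ)
      S.β S.u _ hm Y
  -- `x_j = x̄` for `j ≤ K`
  have hxj : ∀ j < S.K + 1, Real.exp 2 * (S.kap j + S.rho j) * S.t j = flowX := fun j hj =>
    flow_x_eq h.A_pos h.κ₀_pos hβ (Nat.le_of_lt_succ hj)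
  refine iterEffAction_splitFlow_geometric_refined_of_gramBounded S.cov S.kap h.kap_pos h.gram S.alp h.alp_pos h.rows h.cols S.rho
    h.rho_pos S.V (gridTracked_mem_evenPart _ _ _) (constPart_gridTracked _ _ _) S.Lj (fun j => gridTracked_mem_evenPart _ _ _) hLflow
    S.NL (fun j m => gridTrackedNL_nonneg hβ.le _ _ _) (fun j m p w => sum_norm_kernel_gridTracked_le hβ.le _ _ m p w) S.lam
    (fun j => le_rfl) S.D S.t h.D_nonneg (fun j => (h.t_pos j).le) (fun j => flowT_succ j) ?_ (S.K + 1) ?_ ?_ ?_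
  · -- `V - L_0 = 0`
    intro m p w
    have h0 : S.V - S.Lj 0 = 0 := by rw [Lj, nu, flowNu_zero, sub_self]
    simp [h0]
    exact mul_nonneg (h.D_nonneg 0) (pow_nonneg (h.t_pos 0).le m)
  · intro j hj; rw [hxj j hj]; linarith [flowX_le]
  · intro j hj
    rw [hxj j hj, D_of_le (by omega)]
    exact ((h.budget j (Nat.le_of_lt_succ hj)).2.2).trans_lt flowEps_lt_one
  · intro j hj
    rw [hxj j hj, D_of_le (by omega), D_of_le (by omega), flowD_succ]

/-- **The total partition function is a unit and the full effective action is `𝒱^{(K+1)}`.**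
[cite: BenfattoGiulianiMastropietro2006, §2.2 (2.13)-(2.14)] -/
theorem Valid.effAction_full_eq (h : S.Valid) :
    effAction ℂ ((hubbardGridSub L M S.β N).transpose * hubbardCovFullShifted L M S.β S.μR S.θ * hubbardGridSub L M S.β N) S.V =
        iterEffAction ℂ S.cov (S.K + 1) S.V ∧
      IsUnit (effPartitionFn ℂ ((hubbardGridSub L M S.β N).transpose * hubbardCovFullShifted L M S.β S.μR S.θ * hubbardGridSub L M S.β N) S.V) := by
  have hsum : ∑ j ∈ range (S.K + 1), S.cov j =
      (hubbardGridSub L M S.β N).transpose * hubbardCovFullShifted L M S.β S.μR S.θ * hubbardGridSub L M S.β N :=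
    sum_gridScaleCov h.β_pos S.μR S.θ S.Λ₀ flowR h.K_ne_zero
  obtain ⟨hunits, -, -, -⟩ := h.flow (S.K + 1) le_rfl
  obtain ⟨hA, -, hU⟩ := effAction_sum_range_eq_iterEffAction (R := ℂ) S.cov (constPart_gridTracked _ _ _) (S.K + 1) hunits
  rw [hsum] at hA hU
  exact ⟨hA, hU⟩

omit [NeZero N] in
/-- `t_{K+1}² = 1/(A Λ_K)`. [cite: BenfattoGiulianiMastropietro2006, §2.8 (2.85)] -/
theorem Valid.t_last_sq (h : S.Valid) : S.t (S.K + 1) ^ 2 = 1 / (S.A * S.scale S.K) := by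
  have h1 : S.t (S.K + 1) = (S.kap S.K)⁻¹ := by
    show flowT S.A S.κ₀ S.β S.Λ₀ S.K (S.K + 1) = (flowKap S.A S.κ₀ S.β S.Λ₀ S.K S.K)⁻¹
    rw [flowT_succ, flowRho, if_neg h.K_ne_zero]
  rw [h1, inv_pow, flowKap_sq h.A_pos.le h.β_pos h.K_ne_zero le_rfl, one_div]

/-- **The last deviation constant**: `D_{K+1} ≤ (1/29) · e/a_K`, `a_K = e α_K/κ_K²` (from `D_K ≤ P_K`, `σ_K, U_K ≤ 1/60`,
`Θ_K ≤ 1/30`). [cite: BenfattoGiulianiMastropietro2006, §2.8 (2.88)] -/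
theorem Valid.D_last_le (h : S.Valid) : S.D (S.K + 1) ≤ 1 / 29 * (Real.exp 1 / S.a S.K) := by
  have hK := h.K_ne_zero
  obtain ⟨hD0, hDP, hθ⟩ := h.budget S.K le_rfl
  rw [D_of_le le_rfl, flowD_succ]
  set Dk := flowD (fun _ => flowX) S.alp S.kap S.lam S.K with hDk
  have ha := h.a_pos S.K
  have hg : 0 ≤ flowX ^ 2 / (1 - flowX ^ 2) := div_nonneg (sq_nonneg _) (by linarith [flowX_sq_lt_one])
  -- `θ := e α (Λ + D g)/κ² = a (Λ + g D) ≤ a(Λ + g P) = Θ_K ≤ 1/30`; `aΛ = σ_K ≤ 1/60`, `a g P = U_K ≤ 1/60`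
  have hσ := (h.sigma_small hK le_rfl).1
  have hU := (h.U_le S.K hK le_rfl).2
  set θ := Real.exp 1 * S.alp S.K * (S.lam S.K + Dk * flowX ^ 2 / (1 - flowX ^ 2)) / S.kap S.K ^ 2 with hθdef
  have hθε : θ ≤ flowEps := hθ
  have hθ1 : θ ≤ 1 / 30 := by rw [flowEps] at hθε; exact hθε
  have hθ0 : 0 ≤ θ := by
    rw [hθdef]
    exact div_nonneg (mul_nonneg (mul_nonneg (Real.exp_pos 1).le (h.alp_pos _).le)
      (add_nonneg (h.lam_nonneg _) (by rw [mul_div_assoc]; exact mul_nonneg hD0 hg))) (pow_pos (h.kap_pos _) 2).le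
  -- `Λ + D g ≤ (σ_K + U_K)/a_K ≤ (1/30)/a_K`
  have hsum : S.lam S.K + Dk * flowX ^ 2 / (1 - flowX ^ 2) ≤ 1 / 30 / S.a S.K := by
    rw [le_div_iff₀ ha]
    have h1 : (S.lam S.K + Dk * flowX ^ 2 / (1 - flowX ^ 2)) * S.a S.K ≤ S.a S.K * S.lam S.K + S.U S.K := by
      rw [U, flowG]
      have : Dk * flowX ^ 2 / (1 - flowX ^ 2) * S.a S.K ≤ S.P S.K * flowX ^ 2 / (1 - flowX ^ 2) * S.a S.K := by
        rw [mul_div_assoc, mul_div_assoc]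
        exact mul_le_mul_of_nonneg_right (mul_le_mul_of_nonneg_right hDP hg) ha.le
      have e1 : S.P S.K * flowX ^ 2 / (1 - flowX ^ 2) * S.a S.K = S.a S.K * (flowX ^ 2 / (1 - flowX ^ 2)) * S.P S.K := by ring
      have e2 : (S.lam S.K + Dk * flowX ^ 2 / (1 - flowX ^ 2)) * S.a S.K = S.a S.K * S.lam S.K + Dk * flowX ^ 2 / (1 - flowX ^ 2) * S.a S.K := by
        ring
      linarith
    linarith
  have hfrac : θ / (1 - θ) ≤ 1 / 29 := by
    rw [div_le_iff₀ (by linarith)]; linarith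
  calc Real.exp 1 * (Dk * flowX ^ 2 / (1 - flowX ^ 2) + (S.lam S.K + Dk * flowX ^ 2 / (1 - flowX ^ 2)) * θ / (1 - θ))
      ≤ Real.exp 1 * (1 / 30 / S.a S.K + (1 / 30 / S.a S.K) * (1 / 29)) := by
        refine mul_le_mul_of_nonneg_left ?_ (Real.exp_pos 1).le
        have hDg : Dk * flowX ^ 2 / (1 - flowX ^ 2) ≤ 1 / 30 / S.a S.K :=
          le_trans (by linarith [h.lam_nonneg S.K]) hsum
        have : (S.lam S.K + Dk * flowX ^ 2 / (1 - flowX ^ 2)) * θ / (1 - θ) =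
            (S.lam S.K + Dk * flowX ^ 2 / (1 - flowX ^ 2)) * (θ / (1 - θ)) := by ring
        rw [this]
        exact add_le_add hDg (mul_le_mul hsum hfrac (div_nonneg hθ0 (by linarith))
          (by have := h.a_pos S.K; positivity))
    _ = 1 / 29 * (Real.exp 1 / S.a S.K) := by ring

/-- **The pinned norm of the untracked remainder in degree `m` after the last scale, explicitly**:
`D_{K+1} t_{K+1}^m ≤ (1/29)(e/a_K) (A Λ_K)^{-m/2}` with `e/a_K = κ_K²/α_K = A Λ_K · Λ_K√Λ_K β/(C_sl N)`; in degree two this is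
`(1/29) · Λ_K √Λ_K · β/(C_sl N) = (1/29) π√(π/β)/(C_sl N)`. [cite: BenfattoGiulianiMastropietro2006, §2.8 (2.88)] -/
theorem Valid.D_last_mul_t_sq_le (h : S.Valid) :
    S.D (S.K + 1) * S.t (S.K + 1) ^ 2 ≤ 1 / 29 * (Real.pi * Real.sqrt (Real.pi / S.β) / (S.Csl * N)) := by
  have hK := h.K_ne_zero
  have hβ := h.β_pos
  have hN : (0 : ℝ) < N := by exact_mod_cast Nat.pos_of_ne_zero (NeZero.ne N)
  have hΛ : S.scale S.K = Real.pi / S.β := by rw [scale, gridScale_last S.β S.Λ₀ flowR hK]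
  have hΛpos : 0 < S.scale S.K := h.scale_pos _
  have ht2 := h.t_last_sq
  have hD := h.D_last_le
  have ha : S.a S.K = Real.exp 1 * S.Csl * (N / S.β) / (S.A * (S.scale S.K ^ 2 * Real.sqrt (S.scale S.K))) := by
    have hκ2 : S.kap S.K ^ 2 = S.A * S.scale S.K := flowKap_sq h.A_pos.le hβ hK le_rfl
    simp only [a, alp, if_neg hK, if_pos le_rfl, hκ2]
    have := h.A_pos
    field_simp
  have hA := h.A_pos; have hC := h.Csl_pos
  have hsq : 0 < Real.sqrt (S.scale S.K) := Real.sqrt_pos.2 hΛpos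
  calc S.D (S.K + 1) * S.t (S.K + 1) ^ 2 ≤ 1 / 29 * (Real.exp 1 / S.a S.K) * S.t (S.K + 1) ^ 2 :=
        mul_le_mul_of_nonneg_right hD (sq_nonneg _)
    _ = 1 / 29 * (S.scale S.K * Real.sqrt (S.scale S.K) / (S.Csl * N) * S.β) := by
        rw [ht2, ha]
        have he := (Real.exp_pos 1).ne'
        field_simp
    _ = 1 / 29 * (Real.pi * Real.sqrt (Real.pi / S.β) / (S.Csl * N)) := by
        rw [hΛ]; field_simp

end FlowSetup

end Literature.MathematicalPhysics.QuantumLattice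

end
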